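import Literature.Computability.Complexity.HardcoreInapproximabilityGadget
import Literature.Computability.AlgebraicComplexity.MultiTypeClassCount
import HarnessLib

/-!
# Sly's second moment for the gadget core, exactly (incidence tables of two rectangles)

Towards Sly 2010 Theorem 3.10 (hypothesis `HT6` of `slyGadgetReduction_of_thm310`): the exact
finite form of the second moment `E[(Z^{α,β}_{G̃}(η))²]` of the slice partition functions of the
random core `G̃` (Sly's eq. (e:gt2Moment), after Mossel–Weitz–Wormald's formula for
`E[(Z^{α,β})²]`), organised — following Galanis–Štefankovič–Vigoda's view of the second moment as
the first moment of the PAIRED spin system (JACM 2015 §2, eq. (5): a sum over edge-incidence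
tables `Y`) — as a sum over the class-incidence matrices of each matching between the four
classes `(in/out of configuration 1) × (in/out of configuration 2)` on the two sides.

Contents (all proved; two small `Equiv` constructions and counting definitions, no named facts):
* `permCompEquiv`, `card_perm_comp_eq(_zero)` — permutations `π` with `M ∘ π = f` are families of
  bijections between classes: `#{π : M ∘ π = f} = Π_k |M⁻¹ k|!`.
* `incMatrix`, `incClass`, `card_perm_incMatrix_eq(_zero)` — **permutations with a prescribed
  class-incidence matrix**: `#{π : inc(P, M ∘ π) = z} = |incClass P z| · Π_k m_k!`;
  `card_incClass_eq_prod_multinomial` (`= Π_i multinomial(z_i·)`, via the laser-method files'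
  `multiTypeClass`).
* `pairClass`, `PairForbidden`, `avoid_two_iff_incMatrix`, `card_perm_avoid_two_eq_sum`,
  `pairSizes`, `pairAvoidTermN`, `pairAvoidSum`, `card_perm_avoid_two` — **the number of perfect
  matchings avoiding two rectangles** `A₁ × B₁`, `A₂ × B₂` as the explicit table sum
  `Σ_z 𝟙[z = 0 on forbidden cells, margins = class sizes] (Π_i multinomial(z_i·)) Π_k m_k!`.
* `card_powersetCard_filter_inter_card`, `sum_powersetCard_sq_eq_sum_inter` — pairs of `a`-sets by
  intersection size: `C(n,a) C(a,g) C(n-a,a-g)`.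
* `slyZab` (`Z_{a,b}(ω; η)` as a count), `card_realisations_both`, **`sly_secondMoment_count`**:
  `Σ_ω Z_{a,b}(ω)² = Σ_{g ≤ a, h ≤ b} [C(n,a)C(a,g)C(n-a,a-g)][C(n,b)C(b,h)C(n-b,b-h)] K_big(g,h)^q K_small(g,h)`.

Design: the table form (rather than Sly's/MWW's form with the single inner variable `ε`, which is
the Vandermonde collapse of one table coordinate) is what the matrix-norm bound
`HardcoreInapproximabilitySecondMomentBound.pair_table_entropy_le_two_slyPhi1` consumes term by
term; the `ε`-form is recovered locally for the Laplace evaluation. Not here: the entropy bounds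
on the terms and the asymptotics.

## References
* A. Sly, *Computational transition at the uniqueness threshold*, FOCS 2010, §3, proof of Lemma 3.5,
  eq. (e:gt2Moment).
* E. Mossel, D. Weitz, N. Wormald, PTRF 143 (2009), §5 and proof of Theorem 6.11 (the formula for
  `E[(Z^{α,β})²]`: "the three lines correspond to the probability of the following three events").
* A. Galanis, D. Štefankovič, E. Vigoda, J. ACM 62 (2015), §2 eqs. (3)–(6) (moments as sums over
  incidence tables; Remark 2.1: the paired-spin system).
-/

namespace Literature.Computability.Complexity

open Finset

section PermComp

variable {α κ : Type*} [Fintype α] [DecidableEq α] [Fintype κ] [DecidableEq κ]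

/-- The permutations `π` of `α` carrying a given class map `f` onto a reference class map `M`
(`M ∘ π = f`) correspond to families of bijections between the classes of `f` and those of `M`.
[folklore] -/
def permCompEquiv (M f : α → κ) :
    {π : Equiv.Perm α // ∀ a, M (π a) = f a} ≃ (∀ k, {a // f a = k} ≃ {b // M b = k}) where
  toFun π := fun k =>
    { toFun := fun a => ⟨π.1 a.1, by rw [π.2, a.2]⟩
      invFun := fun b => ⟨π.1.symm b.1, by rw [← π.2 (π.1.symm b.1), Equiv.apply_symm_apply, b.2]⟩
      left_inv := fun a => Subtype.ext (by simp)
      right_inv := fun b => Subtype.ext (by simp) }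
  invFun e := ⟨Equiv.ofFiberEquiv e, fun a => Equiv.ofFiberEquiv_map e a⟩
  left_inv π := by
    apply Subtype.ext
    ext a
    rfl
  right_inv e := by
    funext k
    ext a
    simp only [Equiv.coe_fn_mk, Equiv.ofFiberEquiv_apply]
    -- transport along `f a = k`
    obtain ⟨a, rfl⟩ := a
    rfl

/-- **Counting permutations with a prescribed class map**: if every class of `f` has the size of
the corresponding class of `M`, then `#{π : M ∘ π = f} = Π_k |M⁻¹(k)|!`. [folklore] -/
theorem card_perm_comp_eq (M f : α → κ)
    (h : ∀ k, Fintype.card {a // f a = k} = Fintype.card {b // M b = k}) :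
    Fintype.card {π : Equiv.Perm α // ∀ a, M (π a) = f a} =
      ∏ k, (Fintype.card {b // M b = k}).factorial := by
  classical
  rw [Fintype.card_congr (permCompEquiv M f), Fintype.card_pi]
  refine Finset.prod_congr rfl fun k _ => ?_
  -- `|{a // f a = k} ≃ {b // M b = k}| = |{b // M b = k}|!`
  obtain ⟨e⟩ : Nonempty ({a // f a = k} ≃ {b // M b = k}) := Fintype.card_eq.1 (h k)
  rw [Fintype.card_congr (Equiv.equivCongr e (Equiv.refl _)), Fintype.card_perm]

omit [Fintype κ] in
/-- If some class of `f` has the wrong size, no permutation carries `f` onto `M`. [folklore] -/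
theorem card_perm_comp_eq_zero (M f : α → κ) {k : κ}
    (h : Fintype.card {a // f a = k} ≠ Fintype.card {b // M b = k}) :
    Fintype.card {π : Equiv.Perm α // ∀ a, M (π a) = f a} = 0 := by
  classical
  rw [Fintype.card_eq_zero_iff]
  refine ⟨fun π => h ?_⟩
  exact Fintype.card_congr ((permCompEquiv M f π) k)

end PermComp

section Incidence

variable {α ι κ : Type*} [Fintype α] [DecidableEq α] [Fintype ι] [DecidableEq ι] [Fintype κ]
  [DecidableEq κ]

/-- The class-incidence matrix of a map `g : α → κ` against the domain classes `P : α → ι`: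
`inc P g i k = #{a : P a = i, g a = k}`. [folklore] -/
def incMatrix (P : α → ι) (g : α → κ) (i : ι) (k : κ) : ℕ :=
  (univ.filter fun a => P a = i ∧ g a = k).card

omit [Fintype ι] in
/-- Row sums of the incidence matrix are the domain class sizes. [folklore] -/
theorem sum_incMatrix_right (P : α → ι) (g : α → κ) (i : ι) :
    ∑ k, incMatrix P g i k = (univ.filter fun a => P a = i).card := by
  unfold incMatrix
  rw [← Finset.card_biUnion]
  · congr 1
    ext a
    simp
  · intro k _ k' _ hkk'
    rw [Function.onFun, Finset.disjoint_left]
    intro a ha ha'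
    simp only [Finset.mem_filter, Finset.mem_univ, true_and] at ha ha'
    exact hkk' (ha.2.symm.trans ha'.2)

omit [Fintype κ] in
/-- Column sums of the incidence matrix are the class sizes of `g`. [folklore] -/
theorem sum_incMatrix_left (P : α → ι) (g : α → κ) (k : κ) :
    ∑ i, incMatrix P g i k = (univ.filter fun a => g a = k).card := by
  unfold incMatrix
  rw [← Finset.card_biUnion]
  · congr 1
    ext a
    simp
  · intro i _ i' _ hii'
    rw [Function.onFun, Finset.disjoint_left]
    intro a ha ha'
    simp only [Finset.mem_filter, Finset.mem_univ, true_and] at ha ha'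
    exact hii' (ha.1.symm.trans ha'.1)

/-- The maps with a prescribed class-incidence matrix (a multi-class type class). [folklore] -/
def incClass (P : α → ι) (z : ι → κ → ℕ) : Finset (α → κ) :=
  univ.filter fun g => incMatrix P g = z

/-- Membership in `incClass`. [folklore] -/
theorem mem_incClass {P : α → ι} {z : ι → κ → ℕ} {g : α → κ} :
    g ∈ incClass P z ↔ incMatrix P g = z := by
  simp [incClass]

/-- **Permutations with a prescribed class-incidence matrix.** For domain classes `P : α → ι`,
codomain classes `M : α → κ` (sizes `m_k`) and a matrix `z` whose column sums are the `m_k`,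
`#{π : inc(P, M ∘ π) = z} = |incClass P z| · Π_k m_k!` (choose the class map `M ∘ π`, then
biject class by class); in particular the count depends on `M` only through the class sizes.
[folklore] -/
theorem card_perm_incMatrix_eq (P : α → ι) (M : α → κ) (z : ι → κ → ℕ)
    (hcol : ∀ k, ∑ i, z i k = (univ.filter fun b => M b = k).card) :
    Fintype.card {π : Equiv.Perm α // incMatrix P (M ∘ π) = z} =
      (incClass P z).card * ∏ k, ((univ.filter fun b => M b = k).card).factorial := by
  classical
  -- fibre over the class map `g = M ∘ π ∈ incClass P z`
  have hiff : ∀ π : Equiv.Perm α, incMatrix P (M ∘ π) = z ↔ (M ∘ ⇑π) ∈ incClass P z :=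
    fun π => mem_incClass.symm
  rw [← Fintype.card_congr (Equiv.sigmaSubtypeFiberEquivSubtype (fun π : Equiv.Perm α => M ∘ ⇑π)
    (p := fun π => incMatrix P (M ∘ π) = z) (q := fun g => g ∈ incClass P z) hiff)]
  rw [Fintype.card_sigma]
  have hterm : ∀ g : {g // g ∈ incClass P z},
      Fintype.card {π : Equiv.Perm α // (M ∘ ⇑π) = g.1} =
        ∏ k, ((univ.filter fun b => M b = k).card).factorial := by
    intro g
    have hg := mem_incClass.1 g.2
    have hsize : ∀ k, Fintype.card {a // g.1 a = k} = Fintype.card {b // M b = k} := by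
      intro k
      rw [Fintype.card_subtype, Fintype.card_subtype, ← hcol k, ← sum_incMatrix_left P g.1 k, hg]
    have h := card_perm_comp_eq M g.1 hsize
    have e : {π : Equiv.Perm α // (M ∘ ⇑π) = g.1} ≃ {π : Equiv.Perm α // ∀ a, M (π a) = g.1 a} :=
      Equiv.subtypeEquivRight fun π => funext_iff
    rw [Fintype.card_congr e, h]
    refine Finset.prod_congr rfl fun k _ => ?_
    rw [Fintype.card_subtype]
  simp only [hterm, Finset.sum_const, Finset.card_univ, Fintype.card_coe, smul_eq_mul]

/-- With a wrong column sum there is no such permutation. [folklore] -/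
theorem card_perm_incMatrix_eq_zero (P : α → ι) (M : α → κ) (z : ι → κ → ℕ) {k : κ}
    (hcol : ∑ i, z i k ≠ (univ.filter fun b => M b = k).card) :
    Fintype.card {π : Equiv.Perm α // incMatrix P (M ∘ π) = z} = 0 := by
  rw [Fintype.card_eq_zero_iff]
  refine ⟨fun π => hcol ?_⟩
  rw [← π.2, sum_incMatrix_left]
  -- `#{a : M (π a) = k} = #{b : M b = k}`
  refine Finset.card_bij (fun a _ => π.1 a) (fun a ha => ?_) (fun a _ a' _ h => π.1.injective h)
    (fun b hb => ⟨π.1.symm b, ?_, by simp⟩)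
  · simpa using ha
  · simpa using hb

end Incidence

section Multinomial

variable {α ι κ : Type*} [Fintype α] [DecidableEq α] [Fintype ι] [DecidableEq ι] [Fintype κ]
  [DecidableEq κ]

/-- `incClass` is the multi-class type class of the laser-method files. [folklore] -/
theorem incClass_eq_multiTypeClass (P : α → ι) (z : ι → κ → ℕ) :
    incClass P z = Literature.Computability.AlgebraicComplexity.multiTypeClass P z := by
  ext g
  rw [mem_incClass, Literature.Computability.AlgebraicComplexity.mem_multiTypeClass]
  constructor
  · intro h i k
    rw [← h, Literature.Computability.AlgebraicComplexity.countOn_apply, incMatrix,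
      Finset.filter_filter]
  · intro h
    funext i k
    rw [← h i k, Literature.Computability.AlgebraicComplexity.countOn_apply, incMatrix,
      Finset.filter_filter]

/-- **`|incClass P z| = Π_i multinomial(z_i·)`** when the row sums of `z` are the class sizes of `P`.
[folklore] -/
theorem card_incClass_eq_prod_multinomial (P : α → ι) (z : ι → κ → ℕ)
    (hrow : ∀ i, ∑ k, z i k = (univ.filter fun a => P a = i).card) :
    (incClass P z).card = ∏ i, Nat.multinomial univ (z i) := by
  rw [incClass_eq_multiTypeClass]
  refine Literature.Computability.AlgebraicComplexity.card_multiTypeClass_eq_prod_multinomial P z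
    fun i => ?_
  rw [hrow i, Fintype.card_subtype]

/-- With a wrong row sum the class is empty. [folklore] -/
theorem incClass_eq_empty (P : α → ι) (z : ι → κ → ℕ) {i : ι}
    (hrow : ∑ k, z i k ≠ (univ.filter fun a => P a = i).card) : incClass P z = ∅ := by
  rw [Finset.eq_empty_iff_forall_notMem]
  intro g hg
  rw [mem_incClass] at hg
  exact hrow (by rw [← hg, sum_incMatrix_right])

end Multinomial

section TwoRectangles

variable {α : Type*} [Fintype α] [DecidableEq α]

/-- The class of a point relative to two subsets: (membership in the first, in the second). [folklore] -/
def pairClass (A₁ A₂ : Finset α) (a : α) : Bool × Bool := (decide (a ∈ A₁), decide (a ∈ A₂))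

/-- The forbidden incidences of the paired hard-core constraint: an occupied plus vertex of layer `t`
matched to an occupied minus vertex of the same layer. [folklore] -/
def PairForbidden (i k : Bool × Bool) : Prop := (i.1 = true ∧ k.1 = true) ∨ (i.2 = true ∧ k.2 = true)

/-- `PairForbidden` is decidable. [folklore] -/
instance (i k : Bool × Bool) : Decidable (PairForbidden i k) := by
  unfold PairForbidden; infer_instance

/-- **Avoiding two rectangles is a condition on the class-incidence matrix**: `π(A₁) ∩ B₁ = ∅` and
`π(A₂) ∩ B₂ = ∅` iff the incidence matrix of `π` between the `(A₁,A₂)`-classes and the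
`(B₁,B₂)`-classes vanishes on the forbidden cells. [folklore] -/
theorem avoid_two_iff_incMatrix (A₁ A₂ B₁ B₂ : Finset α) (π : Equiv.Perm α) :
    ((∀ a ∈ A₁, π a ∉ B₁) ∧ ∀ a ∈ A₂, π a ∉ B₂) ↔
      ∀ i k, PairForbidden i k → incMatrix (pairClass A₁ A₂) (pairClass B₁ B₂ ∘ π) i k = 0 := by
  constructor
  · rintro ⟨h1, h2⟩ i k hik
    rw [incMatrix, Finset.card_eq_zero, Finset.filter_eq_empty_iff]
    rintro a - ⟨hPa, hMa⟩
    simp only [Function.comp_apply, pairClass] at hPa hMa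
    rcases hik with ⟨hi, hk⟩ | ⟨hi, hk⟩
    · have ha : a ∈ A₁ := by rw [← hPa] at hi; simpa using hi
      have hb : π a ∈ B₁ := by rw [← hMa] at hk; simpa using hk
      exact h1 a ha hb
    · have ha : a ∈ A₂ := by rw [← hPa] at hi; simpa using hi
      have hb : π a ∈ B₂ := by rw [← hMa] at hk; simpa using hk
      exact h2 a ha hb
  · intro h
    have key : ∀ a, ¬PairForbidden (pairClass A₁ A₂ a) (pairClass B₁ B₂ (π a)) := by
      intro a hf
      have h0 := h _ _ hf
      rw [incMatrix, Finset.card_eq_zero, Finset.filter_eq_empty_iff] at h0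
      exact h0 (Finset.mem_univ a) ⟨rfl, rfl⟩
    refine ⟨fun a ha hb => key a (Or.inl ⟨by simp [pairClass, ha], by simp [pairClass, hb]⟩),
      fun a ha hb => key a (Or.inr ⟨by simp [pairClass, ha], by simp [pairClass, hb]⟩)⟩

/-- The summand of the two-rectangle count for an incidence matrix `z`: zero unless `z` vanishes on
the forbidden cells and has the right column sums, else `|incClass P z| · Π_k m_k!`. [folklore] -/
noncomputable def pairAvoidTerm (A₁ A₂ B₁ B₂ : Finset α) (z : Bool × Bool → Bool × Bool → ℕ) : ℕ :=
  if (∀ i k, PairForbidden i k → z i k = 0) ∧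
      ∀ k, ∑ i, z i k = (univ.filter fun b => pairClass B₁ B₂ b = k).card then
    (incClass (pairClass A₁ A₂) z).card *
      ∏ k, ((univ.filter fun b => pairClass B₁ B₂ b = k).card).factorial
  else 0

/-- **Counting permutations avoiding two rectangles by incidence matrices**:
`#{π : π(A₁) ∩ B₁ = ∅, π(A₂) ∩ B₂ = ∅} = Σ_z pairAvoidTerm(z)`, the sum over all matrices
`z : (Bool × Bool)² → {0,…,|α|}`. [cite: GalanisStefankovicVigoda2015, §2 eq. (5) (the second moment as a sum over edge-incidence tables `Y`)] -/
theorem card_perm_avoid_two_eq_sum (A₁ A₂ B₁ B₂ : Finset α) :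
    Fintype.card {π : Equiv.Perm α // (∀ a ∈ A₁, π a ∉ B₁) ∧ ∀ a ∈ A₂, π a ∉ B₂} =
      ∑ z : Bool × Bool → Bool × Bool → Fin (Fintype.card α + 1),
        pairAvoidTerm A₁ A₂ B₁ B₂ (fun i k => (z i k : ℕ)) := by
  classical
  set P := pairClass A₁ A₂ with hP
  set M := pairClass B₁ B₂ with hM
  -- the incidence matrix, valued in `Fin (|α|+1)`
  have hlt : ∀ (π : Equiv.Perm α) i k, incMatrix P (M ∘ π) i k < Fintype.card α + 1 := by
    intro π i k
    exact Nat.lt_succ_of_le ((Finset.card_filter_le _ _).trans (Finset.card_univ.le))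
  set zf : Equiv.Perm α → (Bool × Bool → Bool × Bool → Fin (Fintype.card α + 1)) :=
    fun π i k => ⟨incMatrix P (M ∘ π) i k, hlt π i k⟩ with hzf
  have hzf_iff : ∀ (π : Equiv.Perm α) (z : Bool × Bool → Bool × Bool → Fin (Fintype.card α + 1)),
      zf π = z ↔ incMatrix P (M ∘ π) = fun i k => (z i k : ℕ) := by
    intro π z
    simp only [hzf, funext_iff, Fin.ext_iff]
  -- fibre decomposition over `zf`
  set Avoid : Equiv.Perm α → Prop := fun π => (∀ a ∈ A₁, π a ∉ B₁) ∧ ∀ a ∈ A₂, π a ∉ B₂ with hAvoid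
  change Fintype.card {π : Equiv.Perm α // Avoid π} = _
  rw [Fintype.card_congr (Equiv.sigmaFiberEquiv (fun x : {π : Equiv.Perm α // Avoid π} => zf x.1)).symm,
    Fintype.card_sigma]
  refine Finset.sum_congr rfl fun z _ => ?_
  rw [Fintype.card_congr (Equiv.subtypeSubtypeEquivSubtypeInter (fun π : Equiv.Perm α => Avoid π)
    (fun π => zf π = z))]
  by_cases hz0 : ∀ i k, PairForbidden i k → ((z i k : ℕ)) = 0
  · -- on such fibres avoidance is automatic
    have e1 : {π : Equiv.Perm α // Avoid π ∧ zf π = z} ≃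
        {π : Equiv.Perm α // incMatrix P (M ∘ π) = fun i k => (z i k : ℕ)} := by
      refine Equiv.subtypeEquivRight fun π => ?_
      rw [← hzf_iff]
      constructor
      · exact fun h => h.2
      · intro h
        refine ⟨?_, h⟩
        rw [hAvoid]
        simp only
        rw [avoid_two_iff_incMatrix, (hzf_iff π z).1 h]
        exact hz0
    rw [Fintype.card_congr e1]
    by_cases hcol : ∀ k, ∑ i, (z i k : ℕ) = (univ.filter fun b => M b = k).card
    · rw [card_perm_incMatrix_eq P M _ hcol, pairAvoidTerm, if_pos ⟨hz0, hcol⟩]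
    · push Not at hcol
      obtain ⟨k, hk⟩ := hcol
      rw [card_perm_incMatrix_eq_zero P M _ hk, pairAvoidTerm, if_neg (fun h => ?_)]
      exact hk (h.2 k)
  · -- off the forbidden-zero matrices the fibre is empty
    rw [pairAvoidTerm, if_neg (fun h => hz0 h.1), Fintype.card_eq_zero_iff]
    refine ⟨fun π => hz0 ?_⟩
    have h := (avoid_two_iff_incMatrix A₁ A₂ B₁ B₂ π.1).1 π.2.1
    rw [(hzf_iff π.1 z).1 π.2.2] at h
    exact h

end TwoRectangles

section PairCount

variable {α : Type*} [Fintype α] [DecidableEq α]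

/-- **Pairs of `a`-subsets with prescribed intersection**: for a fixed `a`-set `S₁` in a type of
size `n`, the `a`-sets `S₂` with `|S₁ ∩ S₂| = g` number `C(a, g) · C(n - a, a - g)` (choose the
common part inside `S₁` and the rest outside). [folklore] -/
theorem card_powersetCard_filter_inter_card (S₁ : Finset α) (a g : ℕ) (hS₁ : S₁.card = a) :
    ((univ.powersetCard a).filter fun S₂ : Finset α => (S₁ ∩ S₂).card = g).card =
      a.choose g * (Fintype.card α - a).choose (a - g) := by
  classical
  -- bijection `S₂ ↦ (S₂ ∩ S₁, S₂ \ S₁)` onto `powersetCard g S₁ × powersetCard (a - g) S₁ᶜ`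
  subst hS₁
  have hcompl : (S₁ᶜ).card = Fintype.card α - S₁.card := by rw [Finset.card_compl]
  rw [← Finset.card_powersetCard g S₁, ← hcompl, ← Finset.card_powersetCard (S₁.card - g) S₁ᶜ,
    ← Finset.card_product]
  by_cases hga : g ≤ S₁.card
  swap
  · -- no such `S₂`: `|S₁ ∩ S₂| ≤ |S₁| = a < g`
    rw [(Finset.powersetCard_eq_empty (s := S₁)).2 (by omega), Finset.empty_product, Finset.card_empty,
      Finset.card_eq_zero, Finset.filter_eq_empty_iff]
    intro S₂ _ h
    have : (S₁ ∩ S₂).card ≤ S₁.card := Finset.card_le_card Finset.inter_subset_left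
    omega
  refine Finset.card_bij (fun S₂ _ => (S₂ ∩ S₁, S₂ \ S₁)) (fun S₂ hS₂ => ?_) (fun S₂ hS₂ S₂' hS₂' h => ?_)
    (fun p hp => ?_)
  · obtain ⟨hS₂, hg⟩ := Finset.mem_filter.1 hS₂
    have ha : S₂.card = S₁.card := (Finset.mem_powersetCard.1 hS₂).2
    rw [Finset.inter_comm] at hg
    refine Finset.mem_product.2 ⟨Finset.mem_powersetCard.2 ⟨Finset.inter_subset_right, hg⟩,
      Finset.mem_powersetCard.2 ⟨fun x hx => Finset.mem_compl.2 (Finset.mem_sdiff.1 hx).2, ?_⟩⟩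
    have := Finset.card_inter_add_card_sdiff S₂ S₁
    show (S₂ \ S₁).card = S₁.card - g
    omega
  · simp only [Prod.mk.injEq] at h
    rw [← Finset.sdiff_union_inter S₂ S₁, ← Finset.sdiff_union_inter S₂' S₁, h.1, h.2]
  · obtain ⟨hp1, hp2⟩ := Finset.mem_product.1 hp
    obtain ⟨h1S, h1c⟩ := Finset.mem_powersetCard.1 hp1
    obtain ⟨h2S, h2c⟩ := Finset.mem_powersetCard.1 hp2
    have hdisj : Disjoint p.1 p.2 := by
      rw [Finset.disjoint_left]
      intro x hx1 hx2
      exact (Finset.mem_compl.1 (h2S hx2)) (h1S hx1)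
    refine ⟨p.1 ∪ p.2, Finset.mem_filter.2 ⟨Finset.mem_powersetCard.2 ⟨Finset.subset_univ _, ?_⟩, ?_⟩, ?_⟩
    · rw [Finset.card_union_of_disjoint hdisj]; omega
    · have : S₁ ∩ (p.1 ∪ p.2) = p.1 := by
        rw [Finset.inter_union_distrib_left, Finset.inter_eq_right.2 h1S]
        have : S₁ ∩ p.2 = ∅ := by
          rw [Finset.eq_empty_iff_forall_notMem]
          intro x hx
          exact (Finset.mem_compl.1 (h2S (Finset.mem_inter.1 hx).2)) (Finset.mem_inter.1 hx).1
        rw [this, Finset.union_empty]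
      rw [this, h1c]
    · have e1 : (p.1 ∪ p.2) ∩ S₁ = p.1 := by
        rw [Finset.union_inter_distrib_right, Finset.inter_eq_left.2 h1S]
        have : p.2 ∩ S₁ = ∅ := by
          rw [Finset.eq_empty_iff_forall_notMem]
          intro x hx
          exact (Finset.mem_compl.1 (h2S (Finset.mem_inter.1 hx).1)) (Finset.mem_inter.1 hx).2
        rw [this, Finset.union_empty]
      have e2 : (p.1 ∪ p.2) \ S₁ = p.2 := by
        rw [Finset.union_sdiff_distrib, Finset.sdiff_eq_empty_iff_subset.2 h1S, Finset.empty_union]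
        exact Finset.sdiff_eq_self_of_disjoint (Finset.disjoint_left.2 fun x hx2 hx1 =>
          (Finset.mem_compl.1 (h2S hx2)) hx1)
      exact Prod.ext e1 e2

/-- **Grouping a double sum over `a`-sets by the intersection size.** [folklore] -/
theorem sum_powersetCard_sq_eq_sum_inter {M : Type*} [AddCommMonoid M] (a : ℕ) (G : ℕ → M) :
    ∑ S₁ ∈ (univ : Finset α).powersetCard a, ∑ S₂ ∈ (univ : Finset α).powersetCard a, G ((S₁ ∩ S₂).card) =
      ∑ g ∈ Finset.range (a + 1),
        ((Fintype.card α).choose a * (a.choose g * (Fintype.card α - a).choose (a - g))) • G g := by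
  classical
  have inner : ∀ S₁ ∈ (univ : Finset α).powersetCard a,
      ∑ S₂ ∈ (univ : Finset α).powersetCard a, G ((S₁ ∩ S₂).card) =
        ∑ g ∈ Finset.range (a + 1), (a.choose g * (Fintype.card α - a).choose (a - g)) • G g := by
    intro S₁ hS₁
    have ha : S₁.card = a := (Finset.mem_powersetCard.1 hS₁).2
    rw [Finset.sum_comp]
    -- the image of the intersection size lies in `range (a+1)`; extend by zero terms
    have hsub : ((univ : Finset α).powersetCard a).image (fun S₂ => (S₁ ∩ S₂).card) ⊆ Finset.range (a + 1) := by
      intro g hg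
      obtain ⟨S₂, -, rfl⟩ := Finset.mem_image.1 hg
      have : (S₁ ∩ S₂).card ≤ S₁.card := Finset.card_le_card Finset.inter_subset_left
      exact Finset.mem_range.2 (by omega)
    rw [Finset.sum_subset hsub]
    · refine Finset.sum_congr rfl fun g _ => ?_
      rw [card_powersetCard_filter_inter_card S₁ a g ha]
    · intro g _ hg
      have h0 : ((univ.powersetCard a).filter fun S₂ : Finset α => (S₁ ∩ S₂).card = g).card = 0 := by
        rw [Finset.card_eq_zero, Finset.filter_eq_empty_iff]
        intro S₂ hS₂ hSg
        exact hg (Finset.mem_image.2 ⟨S₂, hS₂, hSg⟩)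
      rw [h0, zero_smul]
  rw [Finset.sum_congr rfl inner, Finset.sum_const, Finset.card_powersetCard, Finset.card_univ,
    Finset.smul_sum]
  refine Finset.sum_congr rfl fun g _ => ?_
  rw [smul_smul]

end PairCount

section Sizes

variable {α : Type*} [Fintype α] [DecidableEq α]

/-- The class sizes of `pairClass A₁ A₂` in a type of size `N` when `|A₁| = a₁`, `|A₂| = a₂`,
`|A₁ ∩ A₂| = g`: `(g, a₁ - g, a₂ - g, N - (a₁ + a₂ - g))` on `(tt, tf, ft, ff)`. [folklore] -/
def pairSizes (N a₁ a₂ g : ℕ) : Bool × Bool → ℕ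
  | (true, true) => g
  | (true, false) => a₁ - g
  | (false, true) => a₂ - g
  | (false, false) => N - (a₁ + a₂ - g)

/-- The classes of `pairClass A₁ A₂` have the sizes `pairSizes |α| |A₁| |A₂| |A₁ ∩ A₂|`. [folklore] -/
theorem card_filter_pairClass_eq (A₁ A₂ : Finset α) (k : Bool × Bool) :
    (univ.filter fun x => pairClass A₁ A₂ x = k).card =
      pairSizes (Fintype.card α) A₁.card A₂.card (A₁ ∩ A₂).card k := by
  classical
  have htt : (univ.filter fun x => pairClass A₁ A₂ x = (true, true)) = A₁ ∩ A₂ := by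
    ext x; simp [pairClass]
  have htf : (univ.filter fun x => pairClass A₁ A₂ x = (true, false)) = A₁ \ A₂ := by
    ext x; simp [pairClass]
  have hft : (univ.filter fun x => pairClass A₁ A₂ x = (false, true)) = A₂ \ A₁ := by
    ext x; simp [pairClass, and_comm]
  have hff : (univ.filter fun x => pairClass A₁ A₂ x = (false, false)) = (A₁ ∪ A₂)ᶜ := by
    ext x; simp [pairClass]
  obtain ⟨k₁, k₂⟩ := k
  cases k₁ <;> cases k₂ <;> simp only [pairSizes]
  · rw [hff, Finset.card_compl, Finset.card_union]
  · rw [hft, Finset.card_sdiff]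
  · rw [htf, Finset.card_sdiff, Finset.inter_comm]
  · rw [htt]

/-- The fully explicit summand of the two-rectangle count: for class sizes `p` (plus side) and
`m` (minus side) and an incidence matrix `z`, zero unless `z` vanishes on the forbidden cells and has
row sums `p` and column sums `m`, else `(Π_i multinomial(z_i·)) · Π_k m_k!`. [folklore] -/
def pairAvoidTermN (p m : Bool × Bool → ℕ) (z : Bool × Bool → Bool × Bool → ℕ) : ℕ :=
  if (∀ i k, PairForbidden i k → z i k = 0) ∧ (∀ k, ∑ i, z i k = m k) ∧ ∀ i, ∑ k, z i k = p i then
    (∏ i, Nat.multinomial univ (z i)) * ∏ k, (m k).factorial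
  else 0

/-- The two-rectangle count as an explicit table sum: `Σ_z pairAvoidTermN p m z` over
`z : (Bool × Bool)² → {0,…,N}`. [folklore] -/
def pairAvoidSum (N : ℕ) (p m : Bool × Bool → ℕ) : ℕ :=
  ∑ z : Bool × Bool → Bool × Bool → Fin (N + 1), pairAvoidTermN p m fun i k => (z i k : ℕ)

/-- `pairAvoidTerm` depends on the sets only through their class sizes. [folklore] -/
theorem pairAvoidTerm_eq_pairAvoidTermN (A₁ A₂ B₁ B₂ : Finset α) (z : Bool × Bool → Bool × Bool → ℕ) :
    pairAvoidTerm A₁ A₂ B₁ B₂ z =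
      pairAvoidTermN (pairSizes (Fintype.card α) A₁.card A₂.card (A₁ ∩ A₂).card)
        (pairSizes (Fintype.card α) B₁.card B₂.card (B₁ ∩ B₂).card) z := by
  classical
  unfold pairAvoidTerm pairAvoidTermN
  simp only [card_filter_pairClass_eq]
  by_cases h0 : ∀ i k, PairForbidden i k → z i k = 0
  · by_cases hcol : ∀ k, ∑ i, z i k = pairSizes (Fintype.card α) B₁.card B₂.card (B₁ ∩ B₂).card k
    · by_cases hrow : ∀ i, ∑ k, z i k = pairSizes (Fintype.card α) A₁.card A₂.card (A₁ ∩ A₂).card i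
      · rw [if_pos ⟨h0, hcol⟩, if_pos ⟨h0, hcol, hrow⟩, card_incClass_eq_prod_multinomial]
        intro i; rw [hrow i, card_filter_pairClass_eq]
      · rw [if_pos ⟨h0, hcol⟩, if_neg (fun h => hrow h.2.2)]
        push Not at hrow
        obtain ⟨i, hi⟩ := hrow
        rw [incClass_eq_empty (pairClass A₁ A₂) z (i := i) (by rw [card_filter_pairClass_eq]; exact hi),
          Finset.card_empty, zero_mul]
    · rw [if_neg (fun h => hcol h.2), if_neg (fun h => hcol h.2.1)]
  · rw [if_neg (fun h => h0 h.1), if_neg (fun h => h0 h.1)]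

/-- **Counting permutations avoiding two rectangles, explicit**: in a type of size `N`,
`#{π : π(A₁) ∩ B₁ = ∅, π(A₂) ∩ B₂ = ∅} = pairAvoidSum N p m` with `p`, `m` the class sizes of
`(A₁, A₂)` and `(B₁, B₂)`. [folklore] -/
theorem card_perm_avoid_two (A₁ A₂ B₁ B₂ : Finset α) :
    Fintype.card {π : Equiv.Perm α // (∀ a ∈ A₁, π a ∉ B₁) ∧ ∀ a ∈ A₂, π a ∉ B₂} =
      pairAvoidSum (Fintype.card α)
        (pairSizes (Fintype.card α) A₁.card A₂.card (A₁ ∩ A₂).card)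
        (pairSizes (Fintype.card α) B₁.card B₂.card (B₁ ∩ B₂).card) := by
  rw [card_perm_avoid_two_eq_sum, pairAvoidSum]
  refine Finset.sum_congr rfl fun z _ => ?_
  rw [pairAvoidTerm_eq_pairAvoidTermN]

end Sizes

section SecondMoment

variable {n m' q : ℕ}

open scoped Classical in
/-- **`Z_{a,b}(ω; η)`**: the number of slice configurations `(S ⊆ W⁺, T ⊆ W⁻)`, `|S| = a`, `|T| = b`,
which together with the boundary `η = (E⁺, E⁻)` are independent in the core realisation
`ω = (σ, τ)` of Sly's `G̃` (so that `Z^{±}_{G̃}(η) = Σ_{(a,b) ∈ phase} λ^{a+b+|η|} Z_{a,b}`).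
[cite: Sly2010, §3 (the slice partition functions `Z^{α,β}_{G̃}(η)`)] -/
noncomputable def slyZab (n m' q a b : ℕ) (Ep Em : Finset (Fin m'))
    (ω : (Fin q → Equiv.Perm (Fin (n + m'))) × Equiv.Perm (Fin n)) : ℕ :=
  (((univ : Finset (Fin n)).powersetCard a ×ˢ (univ : Finset (Fin n)).powersetCard b).filter
    fun ST => SlyCoreIndep ω.1 ω.2 ST.1 ST.2 Ep Em).card

/-- The plus classes of a pair of slice configurations with a common boundary: `L_i = S_i' ∪ E⁺'`
(`'` = embedded into `Fin (n + m')`) have `|L_i| = |S_i| + |E⁺|` and `|L₁ ∩ L₂| = |S₁ ∩ S₂| + |E⁺|`.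
[folklore] -/
theorem card_inter_map_union (S₁ S₂ : Finset (Fin n)) (E : Finset (Fin m')) :
    ((S₁.map (Fin.castAddEmb m') ∪ E.map (Fin.natAddEmb n)) ∩
        (S₂.map (Fin.castAddEmb m') ∪ E.map (Fin.natAddEmb n))).card = (S₁ ∩ S₂).card + E.card := by
  classical
  have h : (S₁.map (Fin.castAddEmb m') ∪ E.map (Fin.natAddEmb n)) ∩
      (S₂.map (Fin.castAddEmb m') ∪ E.map (Fin.natAddEmb n)) =
      (S₁.map (Fin.castAddEmb m') ∩ S₂.map (Fin.castAddEmb m')) ∪ E.map (Fin.natAddEmb n) := by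
    ext v
    simp only [Finset.mem_inter, Finset.mem_union]
    tauto
  rw [h, ← Finset.map_inter, card_map_castAddEmb_union_map_natAddEmb]

open scoped Classical in
/-- **The realisations compatible with two configurations at once, counted**: the event
`SlyCoreIndep(S₁,T₁) ∧ SlyCoreIndep(S₂,T₂)` factors over the `q` big matchings and the small one,
each avoiding two rectangles; by `card_perm_avoid_two` the count is
`K_big(g,h)^q · K_small(g,h)` with `g = |S₁ ∩ S₂|`, `h = |T₁ ∩ T₂|`.
[cite: Sly2010, proof of Lemma 3.5 (eq. (e:gt2Moment)); MosselWeitzWormald2008, proof of Theorem 6.11] -/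
theorem card_realisations_both {a b : ℕ} (Ep Em : Finset (Fin m')) {S₁ S₂ T₁ T₂ : Finset (Fin n)}
    (hS₁ : S₁.card = a) (hS₂ : S₂.card = a) (hT₁ : T₁.card = b) (hT₂ : T₂.card = b) :
    Fintype.card {ω : (Fin q → Equiv.Perm (Fin (n + m'))) × Equiv.Perm (Fin n) //
        SlyCoreIndep ω.1 ω.2 S₁ T₁ Ep Em ∧ SlyCoreIndep ω.1 ω.2 S₂ T₂ Ep Em} =
      pairAvoidSum (n + m') (pairSizes (n + m') (a + Ep.card) (a + Ep.card) ((S₁ ∩ S₂).card + Ep.card))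
          (pairSizes (n + m') (b + Em.card) (b + Em.card) ((T₁ ∩ T₂).card + Em.card)) ^ q *
        pairAvoidSum n (pairSizes n a a (S₁ ∩ S₂).card) (pairSizes n b b (T₁ ∩ T₂).card) := by
  classical
  set L₁ := S₁.map (Fin.castAddEmb m') ∪ Ep.map (Fin.natAddEmb n) with hL₁
  set L₂ := S₂.map (Fin.castAddEmb m') ∪ Ep.map (Fin.natAddEmb n) with hL₂
  set R₁ := T₁.map (Fin.castAddEmb m') ∪ Em.map (Fin.natAddEmb n) with hR₁
  set R₂ := T₂.map (Fin.castAddEmb m') ∪ Em.map (Fin.natAddEmb n) with hR₂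
  -- factor the event
  have e1 : {ω : (Fin q → Equiv.Perm (Fin (n + m'))) × Equiv.Perm (Fin n) //
      SlyCoreIndep ω.1 ω.2 S₁ T₁ Ep Em ∧ SlyCoreIndep ω.1 ω.2 S₂ T₂ Ep Em} ≃
      {σ : Fin q → Equiv.Perm (Fin (n + m')) // ∀ i, (∀ v ∈ L₁, σ i v ∉ R₁) ∧ ∀ v ∈ L₂, σ i v ∉ R₂} ×
        {τ : Equiv.Perm (Fin n) // (∀ s ∈ S₁, τ s ∉ T₁) ∧ ∀ s ∈ S₂, τ s ∉ T₂} := by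
    refine (Equiv.subtypeEquivRight fun ω => ?_).trans (Equiv.subtypeProdEquivProd
      (p := fun σ : Fin q → Equiv.Perm (Fin (n + m')) => ∀ i, (∀ v ∈ L₁, σ i v ∉ R₁) ∧ ∀ v ∈ L₂, σ i v ∉ R₂)
      (q := fun τ : Equiv.Perm (Fin n) => (∀ s ∈ S₁, τ s ∉ T₁) ∧ ∀ s ∈ S₂, τ s ∉ T₂))
    simp only [SlyCoreIndep, hL₁, hL₂, hR₁, hR₂]
    constructor
    · rintro ⟨⟨h1, h2⟩, h3, h4⟩; exact ⟨fun i => ⟨h1 i, h3 i⟩, h2, h4⟩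
    · rintro ⟨h, h2, h4⟩; exact ⟨⟨fun i => (h i).1, h2⟩, fun i => (h i).2, h4⟩
  rw [Fintype.card_congr e1, Fintype.card_prod]
  congr 1
  · rw [Fintype.card_congr (Equiv.subtypePiEquivPi (β := fun _ : Fin q => Equiv.Perm (Fin (n + m')))
      (p := fun _ π => (∀ v ∈ L₁, π v ∉ R₁) ∧ ∀ v ∈ L₂, π v ∉ R₂)), Fintype.card_pi, Finset.prod_const,
      Finset.card_univ, Fintype.card_fin]
    congr 1
    have hL₁c : L₁.card = a + Ep.card := by rw [hL₁, card_map_castAddEmb_union_map_natAddEmb, hS₁]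
    have hL₂c : L₂.card = a + Ep.card := by rw [hL₂, card_map_castAddEmb_union_map_natAddEmb, hS₂]
    have hR₁c : R₁.card = b + Em.card := by rw [hR₁, card_map_castAddEmb_union_map_natAddEmb, hT₁]
    have hR₂c : R₂.card = b + Em.card := by rw [hR₂, card_map_castAddEmb_union_map_natAddEmb, hT₂]
    have hLi : (L₁ ∩ L₂).card = (S₁ ∩ S₂).card + Ep.card := by rw [hL₁, hL₂, card_inter_map_union]
    have hRi : (R₁ ∩ R₂).card = (T₁ ∩ T₂).card + Em.card := by rw [hR₁, hR₂, card_inter_map_union]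
    have h := card_perm_avoid_two L₁ L₂ R₁ R₂
    rw [Fintype.card_fin, hL₁c, hL₂c, hR₁c, hR₂c, hLi, hRi] at h
    convert h using 2
  · have h := card_perm_avoid_two S₁ S₂ T₁ T₂
    rw [Fintype.card_fin, hS₁, hS₂, hT₁, hT₂] at h
    convert h using 2

open scoped Classical in
/-- **Sly's second moment, exactly** (the finite form of his eq. (e:gt2Moment) = MWW's second
moment formula with the boundary `η` and the `m'` extra vertices): summed over all realisations
`ω = (σ, τ)` of the core,
`Σ_ω Z_{a,b}(ω)² = Σ_{g ≤ a} Σ_{h ≤ b} [C(n,a)C(a,g)C(n-a,a-g)] [C(n,b)C(b,h)C(n-b,b-h)] K_big(g,h)^q K_small(g,h)`,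
where the brackets count the pairs of configurations with overlaps `(g, h)` and `K_big`, `K_small`
are the explicit two-rectangle permutation counts (`pairAvoidSum`) of the big and small matchings.
[cite: Sly2010, proof of Lemma 3.5, eq. (e:gt2Moment); MosselWeitzWormald2008, proof of Theorem 6.11 (the display for `E[(Z^{α,β})²]`)] -/
theorem sly_secondMoment_count (n m' q a b : ℕ) (Ep Em : Finset (Fin m')) :
    ∑ ω : (Fin q → Equiv.Perm (Fin (n + m'))) × Equiv.Perm (Fin n), (slyZab n m' q a b Ep Em ω) ^ 2 =
      ∑ g ∈ Finset.range (a + 1), ∑ h ∈ Finset.range (b + 1),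
        (n.choose a * (a.choose g * (n - a).choose (a - g))) *
          ((n.choose b * (b.choose h * (n - b).choose (b - h))) *
            (pairAvoidSum (n + m') (pairSizes (n + m') (a + Ep.card) (a + Ep.card) (g + Ep.card))
                (pairSizes (n + m') (b + Em.card) (b + Em.card) (h + Em.card)) ^ q *
              pairAvoidSum n (pairSizes n a a g) (pairSizes n b b h))) := by
  classical
  set PA := (univ : Finset (Fin n)).powersetCard a with hPA
  set PB := (univ : Finset (Fin n)).powersetCard b with hPB
  -- the square of the count as a quadruple sum of indicators
  have hsq : ∀ ω : (Fin q → Equiv.Perm (Fin (n + m'))) × Equiv.Perm (Fin n),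
      (slyZab n m' q a b Ep Em ω) ^ 2 =
        ∑ S₁ ∈ PA, ∑ T₁ ∈ PB, ∑ S₂ ∈ PA, ∑ T₂ ∈ PB,
          if SlyCoreIndep ω.1 ω.2 S₁ T₁ Ep Em ∧ SlyCoreIndep ω.1 ω.2 S₂ T₂ Ep Em then 1 else 0 := by
    intro ω
    rw [slyZab, ← hPA, ← hPB, Finset.card_filter, sq, Finset.sum_mul_sum, Finset.sum_product]
    refine Finset.sum_congr rfl fun S₁ _ => Finset.sum_congr rfl fun T₁ _ => ?_
    rw [Finset.sum_product]
    refine Finset.sum_congr rfl fun S₂ _ => Finset.sum_congr rfl fun T₂ _ => ?_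
    by_cases h1 : SlyCoreIndep ω.1 ω.2 S₁ T₁ Ep Em <;> by_cases h2 : SlyCoreIndep ω.1 ω.2 S₂ T₂ Ep Em <;>
      simp [h1, h2]
  simp_rw [hsq]
  -- exchange: realisations inside
  rw [Finset.sum_comm]
  simp_rw [Finset.sum_comm (s := (univ : Finset ((Fin q → Equiv.Perm (Fin (n + m'))) × Equiv.Perm (Fin n))))]
  -- the innermost sum over `ω` is the count of `card_realisations_both`
  have hcount : ∀ S₁ ∈ PA, ∀ T₁ ∈ PB, ∀ S₂ ∈ PA, ∀ T₂ ∈ PB,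
      (∑ ω : (Fin q → Equiv.Perm (Fin (n + m'))) × Equiv.Perm (Fin n),
        if SlyCoreIndep ω.1 ω.2 S₁ T₁ Ep Em ∧ SlyCoreIndep ω.1 ω.2 S₂ T₂ Ep Em then 1 else 0) =
      pairAvoidSum (n + m') (pairSizes (n + m') (a + Ep.card) (a + Ep.card) ((S₁ ∩ S₂).card + Ep.card))
          (pairSizes (n + m') (b + Em.card) (b + Em.card) ((T₁ ∩ T₂).card + Em.card)) ^ q *
        pairAvoidSum n (pairSizes n a a (S₁ ∩ S₂).card) (pairSizes n b b (T₁ ∩ T₂).card) := by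
    intro S₁ hS₁ T₁ hT₁ S₂ hS₂ T₂ hT₂
    rw [Finset.sum_boole, Nat.cast_id, ← card_realisations_both Ep Em (Finset.mem_powersetCard.1 hS₁).2
      (Finset.mem_powersetCard.1 hS₂).2 (Finset.mem_powersetCard.1 hT₁).2 (Finset.mem_powersetCard.1 hT₂).2,
      Fintype.card_subtype]
  rw [Finset.sum_congr rfl fun S₁ hS₁ => Finset.sum_congr rfl fun T₁ hT₁ => Finset.sum_congr rfl
    fun S₂ hS₂ => Finset.sum_congr rfl fun T₂ hT₂ => hcount S₁ hS₁ T₁ hT₁ S₂ hS₂ T₂ hT₂]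
  -- regroup: `T₁` past `S₂`, then by intersection sizes
  simp_rw [Finset.sum_comm (s := PB) (t := PA)]
  -- now the sum is `Σ_{S₁} Σ_{S₂} Σ_{T₁} Σ_{T₂} G(|S₁∩S₂|, |T₁∩T₂|)`
  have hT : ∀ g : ℕ, ∑ T₁ ∈ PB, ∑ T₂ ∈ PB,
      pairAvoidSum (n + m') (pairSizes (n + m') (a + Ep.card) (a + Ep.card) (g + Ep.card))
          (pairSizes (n + m') (b + Em.card) (b + Em.card) ((T₁ ∩ T₂).card + Em.card)) ^ q *
        pairAvoidSum n (pairSizes n a a g) (pairSizes n b b (T₁ ∩ T₂).card) =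
      ∑ h ∈ Finset.range (b + 1), (n.choose b * (b.choose h * (n - b).choose (b - h))) *
        (pairAvoidSum (n + m') (pairSizes (n + m') (a + Ep.card) (a + Ep.card) (g + Ep.card))
            (pairSizes (n + m') (b + Em.card) (b + Em.card) (h + Em.card)) ^ q *
          pairAvoidSum n (pairSizes n a a g) (pairSizes n b b h)) := by
    intro g
    rw [hPB, sum_powersetCard_sq_eq_sum_inter b (fun h =>
      pairAvoidSum (n + m') (pairSizes (n + m') (a + Ep.card) (a + Ep.card) (g + Ep.card))
          (pairSizes (n + m') (b + Em.card) (b + Em.card) (h + Em.card)) ^ q *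
        pairAvoidSum n (pairSizes n a a g) (pairSizes n b b h))]
    simp only [smul_eq_mul, Fintype.card_fin]
  simp_rw [hT]
  rw [hPA, sum_powersetCard_sq_eq_sum_inter a (fun g => ∑ h ∈ Finset.range (b + 1),
    (n.choose b * (b.choose h * (n - b).choose (b - h))) *
      (pairAvoidSum (n + m') (pairSizes (n + m') (a + Ep.card) (a + Ep.card) (g + Ep.card))
          (pairSizes (n + m') (b + Em.card) (b + Em.card) (h + Em.card)) ^ q *
        pairAvoidSum n (pairSizes n a a g) (pairSizes n b b h)))]
  simp only [smul_eq_mul, Fintype.card_fin, Finset.mul_sum]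

end SecondMoment

end Literature.Computability.Complexity
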